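import Mathlib
import Summits.ValiantsHypothesis.ValiantsHypothesis.Theorems.BarrierLeverPartitionMinorsHitByVPHiddenStatesSecondShellOriented

/-!
# Route BarrierLever — item `PartitionMinorsHitByVP` (stmt-ValiantsHypothesis-19717), line `hidden-states`:
# SECOND-SHELL «NESTED-PATH» CLASSES — toolkit for the first CANCELLATION cell (rows, relation, identity)

Helper file (`--supports stmt-ValiantsHypothesis-19717`; cell valiant-natproofs, 𝒟-side door (c), registered line
`Cruxes/PartitionMinorsHitByVP/Lines/hidden_states.lean` v8; prover seat val-np-p6 gen 17).  Closes NO item; definition-free.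

THE MECHANISM (memo HOME/val-np-p6/g17/MEMO-valnp6-g17.md §4 «three movers»).  All previous cells kill a cross minor of the
exchange composition (`…SecondShellExchange`) by a COMBINATORIAL criterion (trapped / unfed / 2U / 1UZ): some invariant family of
indicator columns contains the offending row.  The three t = 3 classes left open by those criteria ({012,013;0145,0456},
{012,013;0245,1245}, {012,013;0456,1456}) vanish only by SIGNED CANCELLATION of histories.  This file lands the first such cell:
an EXPLICIT LINEAR RELATION among twelve rows of the cross minor.

NESTED PATHS.  `C₁∖A₁ = {y_b, y_p}` (one attachment `x₁ = A₁∖C₁`), `C₂∖A₂ = {y_m, y_b, y_p}` (attachments `q₁, q₂`); orient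
path 1 = (y_b < y_p), path 2 = (y_m < y_b < y_p).  With `Z = A₂ ∩ C₂` (inert), on every column `J` of size `≤ t` the row of
`C₂ = Z ∪ {y_m,y_b,y_p}` is the combination `nested_budget_identity` of the rows `Z ∪ T`, `T ∈ {{m,p},{p,q₁},{p,q₂},{b,m},{m,x₁},
{m,q₁},{m,q₂},{q₁,q₂},{m},{q₁},{q₂}}` — none of which is `A₁` when `y_m ∉ A₁` (and `Z ∪ {q₁,q₂} = A₂ ≠ A₁`).  THIS FILE:
the generic `det_mat_eq_zero_of_rel` (a row relation kills the determinant), the closed-form rows of the `k = 1, 2` path tables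
(`row₁_bot/top`, `row₂_bot/mid/top`, `row_unit`) and the budget-two identity `nested_budget_identity` (64-case check).  The cell
itself is `…SecondShellNested.exists_table_secondShell_nested`.

HONEST LABEL: conjecture-column cells (second shell, every `t, h`); 19717 stays OPEN; nothing on crux 14610 or VP ≠ VNP.
-/

set_option linter.dupNamespace false

namespace Summit.ValiantsHypothesis.ValiantsHypothesis.Theorems.BarrierLever.HiddenStates

open Finset

noncomputable section

namespace SecondShell

open PathTable

variable {α : Type} [Fintype α] [DecidableEq α]

/-! ## A linear relation among rows kills the determinant -/

omit [Fintype α] [DecidableEq α] in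
/-- if row `i₀` of `mat w rows colJ` is a linear combination of other rows (named by their row sets), the determinant vanishes. -/
theorem det_mat_eq_zero_of_rel (w : α → α → ℂ) {r : ℕ} (rows colJ : Fin r → Finset α) (i₀ : Fin r)
    {n : ℕ} (coef : Fin n → ℂ) (R : Fin n → Finset α) (hall : ∀ l, ∃ i, i ≠ i₀ ∧ rows i = R l)
    (hrel : ∀ kk, ∏ a ∈ rows i₀, ∑ q ∈ colJ kk, w a q = ∑ l, coef l * ∏ a ∈ R l, ∑ q ∈ colJ kk, w a q) :
    (mat w rows colJ).det = 0 := by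
  classical
  choose idx hidx using hall
  set v : Fin r → ℂ := fun i => (if i = i₀ then 1 else 0) - ∑ l ∈ Finset.univ.filter (fun l => idx l = i), coef l
    with hv
  have hempty : Finset.univ.filter (fun l => idx l = i₀) = ∅ :=
    Finset.filter_eq_empty_iff.2 fun l _ => (hidx l).1
  have hvi₀ : v i₀ = 1 := by simp [hv, hempty]
  have hv0 : v ≠ 0 := fun h0 => by
    have := congr_fun h0 i₀
    rw [hvi₀] at this
    exact one_ne_zero this
  apply Matrix.exists_vecMul_eq_zero_iff.1 ⟨v, hv0, ?_⟩
  funext kk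
  simp only [Matrix.vecMul, dotProduct, Pi.zero_apply, mat, Matrix.of_apply]
  set G : Finset α → ℂ := fun S => ∏ a ∈ S, ∑ q ∈ colJ kk, w a q with hG
  have h1 : ∑ i, v i * G (rows i) = G (rows i₀) - ∑ i, (∑ l ∈ Finset.univ.filter (fun l => idx l = i), coef l) * G (rows i) := by
    simp only [hv, sub_mul, Finset.sum_sub_distrib, ite_mul, one_mul, zero_mul, Finset.sum_ite_eq', Finset.mem_univ,
      if_true]
  have h2 : ∑ i, (∑ l ∈ Finset.univ.filter (fun l => idx l = i), coef l) * G (rows i) = ∑ l, coef l * G (R l) := by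
    have h3 : ∀ i, (∑ l ∈ Finset.univ.filter (fun l => idx l = i), coef l) * G (rows i) =
        ∑ l ∈ Finset.univ.filter (fun l => idx l = i), coef l * G (R l) := by
      intro i
      rw [Finset.sum_mul]
      refine Finset.sum_congr rfl fun l hl => ?_
      rw [← (hidx l).2, (Finset.mem_filter.1 hl).2]
    simp_rw [h3]
    exact Finset.sum_fiberwise Finset.univ idx fun l => coef l * G (R l)
  change ∑ i, v i * G (rows i) = 0
  rw [h1, h2, hG]
  simp only
  rw [hrel kk, sub_self]

/-! ## Rows of the short path tables (`k = 1, 2`) in closed form -/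

omit [Fintype α] in
/-- `k = 1`: the bottom `y_b` reads itself and the attachment. -/
theorem row₁_bot {j j' : ℕ} (e : (Fin (1 + 1) ⊕ Fin 1) ⊕ (Fin j ⊕ Fin j') ≃ α) (i : Fin 1) (q : α) :
    swapTable' e (e (Sum.inl (Sum.inl 0))) q =
      (if q = e (Sum.inl (Sum.inl 0)) then 1 else 0) + (if q = e (Sum.inl (Sum.inr i)) then 1 else 0) := by
  obtain ⟨c, rfl⟩ := e.surjective q
  simp only [swapTable', Equiv.symm_apply_apply, EmbeddingLike.apply_eq_iff_eq]
  fin_cases i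
  rcases c with (c | c) | (z | z)
  · fin_cases c <;> simp [coreTable', pw]
  · fin_cases c; simp [coreTable', pw, lvlX]
  · simp [coreTable']
  · simp [coreTable']

omit [Fintype α] in
/-- `k = 1`: the top `y_p` reads itself and `y_b`. -/
theorem row₁_top {j j' : ℕ} (e : (Fin (1 + 1) ⊕ Fin 1) ⊕ (Fin j ⊕ Fin j') ≃ α) (q : α) :
    swapTable' e (e (Sum.inl (Sum.inl (Fin.last 1)))) q =
      (if q = e (Sum.inl (Sum.inl (Fin.last 1))) then 1 else 0) + (if q = e (Sum.inl (Sum.inl 0)) then 1 else 0) := by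
  obtain ⟨c, rfl⟩ := e.surjective q
  simp only [swapTable', Equiv.symm_apply_apply, EmbeddingLike.apply_eq_iff_eq]
  rcases c with (c | c) | (z | z)
  · fin_cases c <;> simp [coreTable', pw]
  · fin_cases c; simp [coreTable', pw, lvlX]
  · simp [coreTable']
  · simp [coreTable']

omit [Fintype α] in
/-- `k = 2`: the bottom `y_m` reads itself and both attachments. -/
theorem row₂_bot {j j' : ℕ} (e : (Fin (2 + 1) ⊕ Fin 2) ⊕ (Fin j ⊕ Fin j') ≃ α) (i i' : Fin 2) (hii' : i ≠ i') (q : α) :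
    swapTable' e (e (Sum.inl (Sum.inl 0))) q =
      (if q = e (Sum.inl (Sum.inl 0)) then 1 else 0) + (if q = e (Sum.inl (Sum.inr i)) then 1 else 0) +
        (if q = e (Sum.inl (Sum.inr i')) then 1 else 0) := by
  obtain ⟨c, rfl⟩ := e.surjective q
  simp only [swapTable', Equiv.symm_apply_apply, EmbeddingLike.apply_eq_iff_eq]
  fin_cases i <;> fin_cases i'
  · exact absurd rfl hii'
  · rcases c with (c | c) | (z | z)
    · fin_cases c <;> simp [coreTable', pw]
    · fin_cases c <;> simp [coreTable', pw, lvlX]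
    · simp [coreTable']
    · simp [coreTable']
  · rcases c with (c | c) | (z | z)
    · fin_cases c <;> simp [coreTable', pw]
    · fin_cases c <;> simp [coreTable', pw, lvlX]
    · simp [coreTable']
    · simp [coreTable']
  · exact absurd rfl hii'

omit [Fintype α] in
/-- `k = 2`: the middle `y_b` reads itself and `y_m`. -/
theorem row₂_mid {j j' : ℕ} (e : (Fin (2 + 1) ⊕ Fin 2) ⊕ (Fin j ⊕ Fin j') ≃ α) (q : α) :
    swapTable' e (e (Sum.inl (Sum.inl 1))) q =
      (if q = e (Sum.inl (Sum.inl 1)) then 1 else 0) + (if q = e (Sum.inl (Sum.inl 0)) then 1 else 0) := by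
  obtain ⟨c, rfl⟩ := e.surjective q
  simp only [swapTable', Equiv.symm_apply_apply, EmbeddingLike.apply_eq_iff_eq]
  rcases c with (c | c) | (z | z)
  · fin_cases c <;> simp [coreTable', pw, Fin.ext_iff]
  · fin_cases c <;> simp [coreTable', pw, lvlX]
  · simp [coreTable']
  · simp [coreTable']

omit [Fintype α] in
/-- `k = 2`: the top `y_p` reads itself and `y_b`. -/
theorem row₂_top {j j' : ℕ} (e : (Fin (2 + 1) ⊕ Fin 2) ⊕ (Fin j ⊕ Fin j') ≃ α) (q : α) :
    swapTable' e (e (Sum.inl (Sum.inl (Fin.last 2)))) q =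
      (if q = e (Sum.inl (Sum.inl (Fin.last 2))) then 1 else 0) + (if q = e (Sum.inl (Sum.inl 1)) then 1 else 0) := by
  obtain ⟨c, rfl⟩ := e.surjective q
  simp only [swapTable', Equiv.symm_apply_apply, EmbeddingLike.apply_eq_iff_eq]
  rcases c with (c | c) | (z | z)
  · fin_cases c <;> simp [coreTable', pw, Fin.ext_iff]
  · fin_cases c <;> simp [coreTable', pw, lvlX]
  · simp [coreTable']
  · simp [coreTable']

omit [Fintype α] in
/-- rows off the path are unit rows. -/
theorem row_unit {k j j' : ℕ} (A C : Finset α) (e : (Fin (k + 1) ⊕ Fin k) ⊕ (Fin j ⊕ Fin j') ≃ α)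
    (m1 : ∀ b, e (Sum.inl (Sum.inl b)) ∈ C \ A) {a : α} (ha : a ∉ C \ A) (q : α) :
    swapTable' e a q = if q = a then 1 else 0 := by
  by_cases hq : q = a
  · rw [hq, if_pos rfl, swapTable'_self]
  · rw [if_neg hq]
    by_contra h'
    exact ha (swapTable'_offdiag A C e m1 h' hq)

/-! ## The budget-two identity of the nested class -/

/-- ★ the explicit relation: with indicators `n_• ∈ {0,1}`, at most two of them `1`, and `Y_m = n_m + ε₁(n_{q₁}+n_{q₂})`,
`Y_b = n_b + ε₀ n_x + ε₁ n_m`, `Y_p = n_p + (ε₀+ε₁) n_b`, the product `Y_m Y_b Y_p` is a fixed combination of the eleven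
products named in the module docstring. -/
theorem nested_budget_identity (ε0 ε1 : ℂ) (nm nb np nx nu nv : ℕ)
    (hm : nm = 0 ∨ nm = 1) (hb : nb = 0 ∨ nb = 1) (hp : np = 0 ∨ np = 1) (hx : nx = 0 ∨ nx = 1)
    (hu : nu = 0 ∨ nu = 1) (hv : nv = 0 ∨ nv = 1) (hle : nm + nb + np + nx + nu + nv ≤ 2)
    (Ym Yb Yp : ℂ) (hYm : Ym = nm + ε1 * (nu + nv)) (hYb : Yb = nb + ε0 * nx + ε1 * nm)
    (hYp : Yp = np + (ε0 + ε1) * nb) :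
    Ym * Yb * Yp =
      ε1 * (Ym * Yp) - ε1 ^ 2 * (Yp * nu) - ε1 ^ 2 * (Yp * nv) + (ε0 + ε1) * (Yb * Ym)
        - ε0 * (ε0 + ε1) * (Ym * nx) - (ε0 + ε1) * ε1 ^ 2 * (Ym * nu) - (ε0 + ε1) * ε1 ^ 2 * (Ym * nv)
        + 2 * (ε0 + ε1) * ε1 ^ 3 * ((nu : ℂ) * nv) - (ε0 + ε1) * ε1 * Ym
        + (ε0 + ε1) * ε1 ^ 2 * (1 + ε1) * nu + (ε0 + ε1) * ε1 ^ 2 * (1 + ε1) * nv := by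
  subst hYm hYb hYp
  rcases hm with rfl | rfl <;> rcases hb with rfl | rfl <;> rcases hp with rfl | rfl <;> rcases hx with rfl | rfl <;>
    rcases hu with rfl | rfl <;> rcases hv with rfl | rfl <;> first | (exfalso; omega) | (push_cast; ring)


/-! ## Set decompositions along a swap -/

omit [Fintype α] in
/-- `C = (C ∖ A) ∪ (A ∩ C)` with a three-element difference. -/
theorem eq_insert₃_inter {A C : Finset α} {a b c : α} (h : C \ A = {a, b, c}) :
    C = insert a (insert b (insert c (A ∩ C))) := by
  ext x
  simp only [Finset.mem_insert, Finset.mem_inter]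
  constructor
  · intro hx
    by_cases hxA : x ∈ A
    · exact Or.inr (Or.inr (Or.inr ⟨hxA, hx⟩))
    · have hx' : x ∈ C \ A := Finset.mem_sdiff.2 ⟨hx, hxA⟩
      rw [h] at hx'
      simp only [Finset.mem_insert, Finset.mem_singleton] at hx'
      rcases hx' with h' | h' | h'
      · exact Or.inl h'
      · exact Or.inr (Or.inl h')
      · exact Or.inr (Or.inr (Or.inl h'))
  · have hsub : ∀ y, y ∈ ({a, b, c} : Finset α) → y ∈ C := fun y hy => by
      rw [← h] at hy; exact (Finset.mem_sdiff.1 hy).1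
    rintro (rfl | rfl | rfl | hx)
    · exact hsub _ (by simp)
    · exact hsub _ (by simp)
    · exact hsub _ (by simp)
    · exact hx.2

omit [Fintype α] in
/-- `A = (A ∖ C) ∪ (A ∩ C)` with a two-element difference. -/
theorem eq_insert₂_inter {A C : Finset α} {a b : α} (h : A \ C = {a, b}) : A = insert a (insert b (A ∩ C)) := by
  ext x
  simp only [Finset.mem_insert, Finset.mem_inter]
  constructor
  · intro hx
    by_cases hxC : x ∈ C
    · exact Or.inr (Or.inr ⟨hx, hxC⟩)
    · have hx' : x ∈ A \ C := Finset.mem_sdiff.2 ⟨hx, hxC⟩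
      rw [h] at hx'
      simp only [Finset.mem_insert, Finset.mem_singleton] at hx'
      rcases hx' with h' | h'
      · exact Or.inl h'
      · exact Or.inr (Or.inl h')
  · have hsub : ∀ y, y ∈ ({a, b} : Finset α) → y ∈ A := fun y hy => by
      rw [← h] at hy; exact (Finset.mem_sdiff.1 hy).1
    rintro (rfl | rfl | hx)
    · exact hsub _ (by simp)
    · exact hsub _ (by simp)
    · exact hx.1


/-! ## The budget-two identity of the inner-bottom nested class (`q₁` inert in the start row) -/

/-- ★ the explicit relation when the attachment `q₁` is an inert token of the start row (its indicator is `1`): with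
`Y_m = n_m + ε₁(1 + n_v)`, `Y_b = n_b + ε₀ n_x + ε₁ n_m`, `Y_p = n_p + (ε₀+ε₁) n_b` and at most two of the five indicators `1`. -/
theorem nested_budget_identity' (ε0 ε1 : ℂ) (nm nb np nx nv : ℕ)
    (hm : nm = 0 ∨ nm = 1) (hb : nb = 0 ∨ nb = 1) (hp : np = 0 ∨ np = 1) (hx : nx = 0 ∨ nx = 1)
    (hv : nv = 0 ∨ nv = 1) (hle : nm + nb + np + nx + nv ≤ 2)
    (Ym Yb Yp : ℂ) (hYm : Ym = nm + ε1 * (1 + nv)) (hYb : Yb = nb + ε0 * nx + ε1 * nm)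
    (hYp : Yp = np + (ε0 + ε1) * nb) :
    Ym * Yb * Yp =
      ε1 * (Yb * Yp) + ε1 * (Ym * Yp) - ε1 ^ 2 * (Yp * nv) + (ε0 + ε1) * (Yb * Ym)
        - ε0 * (ε0 + ε1) * (Ym * nx) - (ε0 + ε1) * ε1 ^ 2 * (Ym * nv)
        - ε1 ^ 2 * Yp - (ε0 + ε1) * ε1 * Yb - (ε0 + ε1) * ε1 * Ym
        + ε0 * (ε0 + ε1) * ε1 * nx + (ε0 + ε1) * ε1 ^ 2 * (1 + 2 * ε1) * nv + (ε0 + ε1) * ε1 ^ 2 := by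
  subst hYm hYb hYp
  rcases hm with rfl | rfl <;> rcases hb with rfl | rfl <;> rcases hp with rfl | rfl <;> rcases hx with rfl | rfl <;>
    rcases hv with rfl | rfl <;> first | (exfalso; omega) | (push_cast; ring)


/-! ## The budget-two identity of the wide nested class (`|A₁∖C₁| = 2`, attachment `x₁` inert in the start row) -/

/-- ★ the explicit relation for path 1 = (y_b < y_p < y_t) with TWO attachments at `y_b`, one of them (`x₁`) an inert token of the
start row: `Y_b = n_b + ε₀(1 + n_x) + ε₁ n_m`, `Y_m = n_m + ε₁(n_u + n_v)`, `Y_p = n_p + (ε₀+ε₁) n_b`, at most two indicators `1`. -/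
theorem nested_budget_identity₂ (ε0 ε1 : ℂ) (nm nb np nx nu nv : ℕ)
    (hm : nm = 0 ∨ nm = 1) (hb : nb = 0 ∨ nb = 1) (hp : np = 0 ∨ np = 1) (hx : nx = 0 ∨ nx = 1)
    (hu : nu = 0 ∨ nu = 1) (hv : nv = 0 ∨ nv = 1) (hle : nm + nb + np + nx + nu + nv ≤ 2)
    (Ym Yb Yp : ℂ) (hYm : Ym = nm + ε1 * (nu + nv)) (hYb : Yb = nb + ε0 * (1 + nx) + ε1 * nm)
    (hYp : Yp = np + (ε0 + ε1) * nb) :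
    Ym * Yb * Yp =
      (ε0 + ε1) * (Ym * Yp) - ε1 ^ 2 * (Yp * nu) - ε1 ^ 2 * (Yp * nv) + (ε0 + ε1) * (Yb * Ym)
        - ε0 * (ε0 + ε1) * (Ym * nx) - (ε0 + ε1) * ε1 ^ 2 * (Ym * nu) - (ε0 + ε1) * ε1 ^ 2 * (Ym * nv)
        + 2 * (ε0 + ε1) * ε1 ^ 3 * ((nu : ℂ) * nv) - (ε0 + ε1) ^ 2 * Ym
        + (ε0 + ε1) * ε1 ^ 2 * (1 + ε1) * nu + (ε0 + ε1) * ε1 ^ 2 * (1 + ε1) * nv := by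
  subst hYm hYb hYp
  rcases hm with rfl | rfl <;> rcases hb with rfl | rfl <;> rcases hp with rfl | rfl <;> rcases hx with rfl | rfl <;>
    rcases hu with rfl | rfl <;> rcases hv with rfl | rfl <;> first | (exfalso; omega) | (push_cast; ring)


/-! ## The budget-two identity of the shared-exit nested class (`x₂ = q₁`) -/

/-- ★ the explicit relation when the second attachment `s` of `y_b` is ALSO an attachment of `y_m` (shared exit):
`Y_m = n_m + ε₁(n_s + n_q)`, `Y_b = n_b + ε₀(n_x + n_s) + ε₁ n_m`, `Y_p = n_p + (ε₀+ε₁) n_b`, at most two indicators `1`. -/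
theorem nested_budget_identity_shared (ε0 ε1 : ℂ) (nm nb np nx ns nq : ℕ)
    (hm : nm = 0 ∨ nm = 1) (hb : nb = 0 ∨ nb = 1) (hp : np = 0 ∨ np = 1) (hx : nx = 0 ∨ nx = 1)
    (hs : ns = 0 ∨ ns = 1) (hq : nq = 0 ∨ nq = 1) (hle : nm + nb + np + nx + ns + nq ≤ 2)
    (Ym Yb Yp : ℂ) (hYm : Ym = nm + ε1 * (ns + nq)) (hYb : Yb = nb + ε0 * (nx + ns) + ε1 * nm)
    (hYp : Yp = np + (ε0 + ε1) * nb) :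
    Ym * Yb * Yp =
      -((ε0 + ε1) * ε1) * Ym + (ε0 + ε1) * ε1 ^ 2 * (1 + ε1) * nq + (ε0 + ε1) * ε1 ^ 2 * (1 + ε1) * ns
        + (ε0 + ε1) * (Yb * Ym) + ε1 * (Ym * Yp) - (ε0 + ε1) * ε1 ^ 2 * (Ym * nq)
        - (ε0 + ε1) * (ε1 ^ 2 + ε0) * (Ym * ns) - ε0 * (ε0 + ε1) * (Ym * nx) - ε1 ^ 2 * (Yp * nq)
        + ε1 * (ε0 - ε1) * (Yp * ns) + 2 * (ε0 + ε1) * ε1 ^ 3 * ((nq : ℂ) * ns) := by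
  subst hYm hYb hYp
  rcases hm with rfl | rfl <;> rcases hb with rfl | rfl <;> rcases hp with rfl | rfl <;> rcases hx with rfl | rfl <;>
    rcases hs with rfl | rfl <;> rcases hq with rfl | rfl <;> first | (exfalso; omega) | (push_cast; ring)

end SecondShell

end

end Summit.ValiantsHypothesis.ValiantsHypothesis.Theorems.BarrierLever.HiddenStates
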